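import Literature.AlgebraicGeometry.HodgeTheory.ComplexTorusCategoryExactness
import Mathlib.CategoryTheory.Limits.ExactFunctor
import HarnessLib

/-!
# Exact functors on complex tori factor through the isogeny category as EXACT functors
# (Brion, §3.1: the universal property of the quotient functor among exact functors)

Layer `Literature/AlgebraicGeometry/HodgeTheory`, namespace `Literature.AlgebraicGeometry.HodgeTheory.ComplexTorusCat`;
lane `lit-hodgefound` (Track 2 foundations library, Layer A1 / A2), prover seat `lit-hodgefound-p35` (gen 9,
row g9-#2), sequel of Q762 `ComplexTorusCategoryLocalization` (the quotient functor
`Q = toIsogeny : ComplexTorusCat ⥤ TorusIsogenyCat` IS the localisation at the isogenies: every functor `G`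
inverting the isogenies factors uniquely as `G = Q ⋙ lift G`) and of g9-#1 `ComplexTorusCategoryExactness`
(`ComplexTorusCat` has kernels `(Ker f)⁰`, cokernels `X′/Im f`, finite (co)limits; `Q` is exact and maps the
(co)kernel forks of `ComplexTorusCat` ONTO Q512's (co)kernel forks of the isogeny category, definitionally).
Brion states the universal property of `Q` for EXACT functors into abelian categories; g8-#1 proved
existence and uniqueness of the factorisation for ALL functors. This file supplies the missing word: the
factorisation of an exact functor IS exact.

Source, verbatim (held copy `paper:arxiv-1602.00222` [Brion2016IsogenyCategory], M. Brion, *Commutative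
algebraic groups up to isogeny*, Documenta Math. 22 (2017), §3.1): p0010 L15–L19 «The category `C/F` is
abelian, and comes with an exact functor `Q : C → C/F`, which is the identity on objects and the natural
map … on morphisms.»; p0010 L24–L29 «The quotient functor `Q` satisfies the following universal property:
given an exact functor `R : C → D`, where `D` is an abelian category, such that `R(F) = 0` for any finite
group `F`, there exists a unique exact functor `S : C/F → D` such that `R = S ∘ Q` (see [Gabriel] for
these results).»; p0010 L74–L77 «Every exact functor `R : C → D`, where `D` is an abelian category and
`R(f)` is an isomorphism for any isogeny `f`, factors uniquely through `C̲` (indeed, `R` must send any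
finite group to zero).»; Lemma 3.1 (iii) p0010 L52–L56 «`f̲` is zero (resp. a monomorphism, an
epimorphism, an isomorphism) if and only if `f` is zero (resp. has a finite kernel, is an epimorphism,
is an isogeny).» Brion's `C` is the abelian category of all commutative algebraic groups over a field and
`F` its Serre subcategory of finite groups; for complex tori (`C = ComplexTorusCat`, whose objects are
connected, so that there is no finite object to kill) the hypothesis reads "`R` inverts the isogenies",
"exact" is "preserves finite limits and finite colimits" (`PreservesFiniteLimits`, `PreservesFiniteColimits`;
`ComplexTorusCat` has them by g9-#1), and the target `D` may be any preadditive category with a zero object.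
Cite-only: P. Gabriel, *Des catégories abéliennes*, Bull. SMF 90 (1962), Ch. III (quotient categories)
— Brion's reference [Gabriel]; H. Lange, *Abelian Varieties over the Complex Numbers* (2023), §1.1.2
Prop. 1.1.10 [Lange2023AbelianVarietiesComplex] (the kernels `(Ker f)⁰` and cokernels `X′/Im f`).

## The argument

Every morphism of the isogeny category is a fraction `φ = (f ⊗ 1)(n_Y ⊗ 1)⁻¹ = (n_X ⊗ 1)⁻¹ (f′ ⊗ 1)` with
`f, f′` holomorphic and `n ≠ 0` (g8-#1 `exists_toIsogHom_eq_comp_intMul` / `_eq_intMul_comp`). The kernel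
fork `Q((Ker f)⁰ ↪ X)` of `f ⊗ 1` (Q512 `TorusIsogenyCat.kernelIsLimit`, which is `Q` of g9-#1's kernel
fork `kerIncl f`, `toIsogHom_kerIncl`) is then a kernel fork of `φ` (`isKernelCompMono`), and a functor `S`
with `Q ⋙ S` kernel-preserving maps it to `R((Ker f)⁰ ↪ X)`, a kernel of `R(f) = S(f ⊗ 1)`, hence of
`S(φ) = S(f ⊗ 1) ∘ S((n ⊗ 1)⁻¹)`. So `S` preserves the kernel of EVERY `φ`; dually for cokernels; and a
kernel- and cokernel-preserving functor between preadditive categories with finite (co)limits and zero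
objects preserves all finite (co)limits (Mathlib `preservesFiniteLimits_of_preservesKernels`).

## Contents (theorems, and three small definitions with bodies; NO named fact, no `sorry`)

* §1 `zero_eq_toIsogeny_map_zero`, `preservesZeroMorphisms_of_toIsogeny_comp` (`S` preserves zero
  morphisms as soon as `Q ⋙ S` does).
* §2 KERNELS: `kerIncl_comp_eq_zero_of_rep`, **`isLimitKernelForkOfRep`** (`Q((Ker f)⁰ ↪ X)` is a kernel of
  `φ = (f ⊗ 1)(n ⊗ 1)⁻¹`), **`preservesLimit_parallelPair_of_toIsogeny_comp`** (if `Q ⋙ S` preserves the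
  kernels of holomorphic homomorphisms, `S` preserves ALL kernels),
  `preservesKernels_of_preservesFiniteLimits_toIsogeny_comp`.
* §3 COKERNELS: `comp_cokerProj_eq_zero_of_rep`, **`isColimitCokernelCoforkOfRep`**,
  **`preservesColimit_parallelPair_of_toIsogeny_comp`**, `preservesCokernels_of_preservesFiniteColimits_toIsogeny_comp`.
* §4 EXACTNESS (target `D` preadditive with a zero object): **`preservesFiniteLimits_of_toIsogeny_comp`**,
  **`preservesFiniteColimits_of_toIsogeny_comp`**, `additive_of_toIsogeny_comp`; the `≅`-versions
  `preservesFiniteLimits_of_iso`, `preservesFiniteColimits_of_iso` (for functors given with `Q ⋙ S ≅ R`,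
  the shape of Mathlib's `Localization.lift`).
* §5 BRION'S UNIVERSAL PROPERTY: **`preservesFiniteLimits_lift`**, **`preservesFiniteColimits_lift`**
  (g8-#1's `lift R` of an exact `R` is exact), `additive_lift`, `preservesFiniteLimits_localizationLift`,
  `preservesFiniteColimits_localizationLift` (Mathlib's `Localization.lift R _ Q`),
  **`existsUnique_exact_toIsogeny_comp_eq`** ("there exists a unique exact functor `S` … such that
  `R = S ∘ Q`"), `exact_of_toIsogeny_comp_eq`; bundled in Mathlib's category of exact functors `C ⥤ₑ D`:
  `toIsogenyExact : ComplexTorusCat ⥤ₑ TorusIsogenyCat`, **`liftExact : (ComplexTorusCat ⥤ₑ D) → … →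
  (TorusIsogenyCat ⥤ₑ D)`**, `toIsogeny_comp_liftExact`, **`existsUnique_exactFunctor`**.
* §6 VALIDATION AND CONSEQUENCES: the hypotheses are inhabited by `R = Q` itself (exact, inverts the
  isogenies; its lift is `𝟭`): `preservesFiniteLimits_lift_toIsogeny`, `existsUnique_exact_toIsogeny`,
  `lift_toIsogeny_eq_id`; `preservesMonomorphisms_lift`, `preservesEpimorphisms_lift`, and Lemma 3.1 (iii)
  transported: **`map_mono_of_exact`** (a left exact `R` inverting the isogenies sends homomorphisms with
  finite kernel to monomorphisms), **`map_epi_of_exact`**.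
-/

noncomputable section

set_option maxSynthPendingDepth 3

open CategoryTheory CategoryTheory.Limits Opposite

universe v' u'

namespace Literature.AlgebraicGeometry.HodgeTheory

open Literature.Geometry.Kaehler Literature.Geometry.Kaehler.ComplexTorus

namespace ComplexTorusCat

variable {D : Type u'} [Category.{v'} D]

/-! ## §1 Functors on the isogeny category are controlled by their restriction along `Q` -/

section Zero

variable [HasZeroMorphisms D] (S : TorusIsogenyCat ⥤ D)

/-- Every morphism `0 : X ⟶ Y` of the isogeny category is `Q(0)` for the zero HOLOMORPHIC homomorphism
(`Q` is the identity on objects). [cite: Brion2016IsogenyCategory, §3.1 p. 10 (p0010 L15–L19: Q is the identity on objects)] -/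
theorem zero_eq_toIsogeny_map_zero (X Y : TorusIsogenyCat) :
    (0 : X ⟶ Y) = toIsogeny.map (0 : of X ⟶ of Y) := (toIsogHom_zero (of X) (of Y)).symm

/-- **A functor `S` on the isogeny category preserves zero morphisms as soon as `Q ⋙ S` does.**
[cite: Brion2016IsogenyCategory, §3.1 p. 10 (p0010 L24–L29)] -/
theorem preservesZeroMorphisms_of_toIsogeny_comp [(toIsogeny ⋙ S).PreservesZeroMorphisms] :
    S.PreservesZeroMorphisms where
  map_zero X Y := by
    rw [zero_eq_toIsogeny_map_zero]
    exact (toIsogeny ⋙ S).map_zero (of X) (of Y)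

end Zero

/-! ## §2 Kernels: `S` preserves every kernel of the isogeny category if `Q ⋙ S` preserves the kernels
of holomorphic homomorphisms -/

section Kernels

variable [HasZeroMorphisms D] (S : TorusIsogenyCat ⥤ D) [S.PreservesZeroMorphisms]

/-- **Every morphism `φ` of the isogeny category has a kernel of the form `Q((Ker f)⁰ ↪ X)`**: writing
`φ = (f ⊗ 1)(n_Y ⊗ 1)⁻¹` (g8-#1 `exists_toIsogHom_eq_comp_intMul`), the kernel fork of `f ⊗ 1` (Q512,
which IS `Q` of the kernel fork `(Ker f)⁰ ↪ X` of `ComplexTorusCat`, g9-#1 `toIsogHom_kerIncl`) is a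
kernel fork of `φ`. [cite: Brion2016IsogenyCategory, §3.1 Lemma 3.1 (iii) and §3.2 Prop. 3.6 (ii)]
[cite: Lange2023AbelianVarietiesComplex, §1.1.2 Prop. 1.1.10 (b) (p0020 L36–L37)] -/
theorem kerIncl_comp_eq_zero_of_rep {X Y : ComplexTorusCat} {φ : X.toIsog ⟶ Y.toIsog} {n : ℤ} [NeZero n]
    {f : X ⟶ Y} (hf : toIsogHom f = φ ≫ toIsogHom (intMul Y n)) : toIsogHom (kerIncl f) ≫ φ = 0 := by
  rw [eq_toIsogHom_comp_inv_intMul hf, ← Category.assoc, ← toIsogHom_comp, kerIncl_comp, toIsogHom_zero,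
    zero_comp]

/-- The kernel fork `Q((Ker f)⁰ ↪ X)` of `φ = (f ⊗ 1)(n ⊗ 1)⁻¹` is a limit.
[cite: Brion2016IsogenyCategory, §3.1 Lemma 3.1 (iii)] [cite: Lange2023AbelianVarietiesComplex, §1.1.2 Prop. 1.1.10 (b) (p0020 L36–L37)] -/
def isLimitKernelForkOfRep {X Y : ComplexTorusCat} {φ : X.toIsog ⟶ Y.toIsog} {n : ℤ} [NeZero n]
    {f : X ⟶ Y} (hf : toIsogHom f = φ ≫ toIsogHom (intMul Y n)) :
    IsLimit (KernelFork.ofι (toIsogHom (kerIncl f)) (kerIncl_comp_eq_zero_of_rep hf)) :=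
  isKernelCompMono (TorusIsogenyCat.kernelIsLimit (X := X.toIsog) (toIsogHom f))
    (inv (toIsogHom (intMul Y n))) (eq_toIsogHom_comp_inv_intMul hf)

/-- **`S` PRESERVES THE KERNEL OF EVERY `φ` AS SOON AS `Q ⋙ S` PRESERVES THE KERNELS OF HOLOMORPHIC
HOMOMORPHISMS** (the heart of "there exists a unique EXACT functor `S` … such that `R = S ∘ Q`": the
kernel `Q((Ker f)⁰ ↪ X)` of `φ = (f ⊗ 1)(n ⊗ 1)⁻¹` is mapped to `R((Ker f)⁰ ↪ X)`, a kernel of `R(f)`,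
hence of `S(φ) = R(f) · S((n ⊗ 1)⁻¹)`). [cite: Brion2016IsogenyCategory, §3.1 p. 10 (p0010 L24–L29 and L74–L77)] -/
theorem preservesLimit_parallelPair_of_toIsogeny_comp
    (hS : ∀ {X Y : ComplexTorusCat} (f : X ⟶ Y), PreservesLimit (parallelPair f 0) (toIsogeny ⋙ S))
    {X Y : TorusIsogenyCat} (φ : X ⟶ Y) : PreservesLimit (parallelPair φ 0) S := by
  obtain ⟨n, f, hn, hf⟩ := exists_toIsogHom_eq_comp_intMul (X := of X) (Y := of Y) φ
  haveI : NeZero n := ⟨hn⟩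
  haveI := hS f
  refine preservesLimit_of_preserves_limit_cone (isLimitKernelForkOfRep hf) ?_
  refine (isLimitMapConeForkEquiv' S (kerIncl_comp_eq_zero_of_rep hf)).symm ?_
  have h1 : IsLimit (KernelFork.ofι (S.map (toIsogHom (kerIncl f)))
      (show S.map (toIsogHom (kerIncl f)) ≫ S.map (toIsogHom f) = 0 by
        rw [← S.map_comp, ← toIsogHom_comp, kerIncl_comp, toIsogHom_zero, S.map_zero]) :
      KernelFork (S.map (toIsogHom f))) :=
    isLimitForkMapOfIsLimit' (toIsogeny ⋙ S) (kerIncl_comp f) (kernelIsLimit f)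
  have hSφ : S.map φ = S.map (toIsogHom f) ≫ S.map (inv (toIsogHom (intMul (of Y) n))) := by
    rw [← S.map_comp, ← eq_toIsogHom_comp_inv_intMul hf]
  exact isKernelCompMono h1 _ hSφ

/-- Instance form: if `Q ⋙ S` preserves finite limits, `S` preserves all kernels.
[cite: Brion2016IsogenyCategory, §3.1 p. 10 (p0010 L24–L29)] -/
theorem preservesKernels_of_preservesFiniteLimits_toIsogeny_comp [PreservesFiniteLimits (toIsogeny ⋙ S)]
    {X Y : TorusIsogenyCat} (φ : X ⟶ Y) : PreservesLimit (parallelPair φ 0) S :=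
  preservesLimit_parallelPair_of_toIsogeny_comp S (fun _ ↦ inferInstance) φ

end Kernels

/-! ## §3 Cokernels, dually -/

section Cokernels

variable [HasZeroMorphisms D] (S : TorusIsogenyCat ⥤ D) [S.PreservesZeroMorphisms]

/-- `φ ∘ Q(X′ ↠ X′/Im f) = 0` for `φ = (n_X ⊗ 1)⁻¹ (f ⊗ 1)`. [cite: Brion2016IsogenyCategory, §3.1 Lemma 3.1 (iii)]
[cite: Lange2023AbelianVarietiesComplex, §1.1.2 Prop. 1.1.10 (a) (p0020 L34–L35)] -/
theorem comp_cokerProj_eq_zero_of_rep {X Y : ComplexTorusCat} {φ : X.toIsog ⟶ Y.toIsog} {n : ℤ} [NeZero n]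
    {f : X ⟶ Y} (hf : toIsogHom f = toIsogHom (intMul X n) ≫ φ) : φ ≫ toIsogHom (cokerProj f) = 0 := by
  rw [eq_inv_toIsogHom_intMul_comp hf, Category.assoc, ← toIsogHom_comp, comp_cokerProj, toIsogHom_zero,
    comp_zero]

/-- **Every morphism `φ` of the isogeny category has a cokernel of the form `Q(X′ ↠ X′/Im f)`**
(`φ = (n_X ⊗ 1)⁻¹ (f ⊗ 1)`; Q512's cokernel cofork of `f ⊗ 1` IS `Q` of g9-#1's, `toIsogHom_cokerProj`).
[cite: Brion2016IsogenyCategory, §3.1 Lemma 3.1 (iii)] [cite: Lange2023AbelianVarietiesComplex, §1.1.2 Prop. 1.1.10 (a) (p0020 L34–L35)] -/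
def isColimitCokernelCoforkOfRep {X Y : ComplexTorusCat} {φ : X.toIsog ⟶ Y.toIsog} {n : ℤ} [NeZero n]
    {f : X ⟶ Y} (hf : toIsogHom f = toIsogHom (intMul X n) ≫ φ) :
    IsColimit (CokernelCofork.ofπ (toIsogHom (cokerProj f)) (comp_cokerProj_eq_zero_of_rep hf)) :=
  isCokernelEpiComp (TorusIsogenyCat.cokernelIsColimit (X := Y.toIsog) (toIsogHom f))
    (inv (toIsogHom (intMul X n))) (eq_inv_toIsogHom_intMul_comp hf)

/-- **`S` PRESERVES THE COKERNEL OF EVERY `φ` AS SOON AS `Q ⋙ S` PRESERVES THE COKERNELS OF HOLOMORPHIC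
HOMOMORPHISMS.** [cite: Brion2016IsogenyCategory, §3.1 p. 10 (p0010 L24–L29 and L74–L77)] -/
theorem preservesColimit_parallelPair_of_toIsogeny_comp
    (hS : ∀ {X Y : ComplexTorusCat} (f : X ⟶ Y), PreservesColimit (parallelPair f 0) (toIsogeny ⋙ S))
    {X Y : TorusIsogenyCat} (φ : X ⟶ Y) : PreservesColimit (parallelPair φ 0) S := by
  obtain ⟨n, f, hn, hf⟩ := exists_toIsogHom_eq_intMul_comp (X := of X) (Y := of Y) φ
  haveI : NeZero n := ⟨hn⟩
  haveI := hS f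
  refine preservesColimit_of_preserves_colimit_cocone (isColimitCokernelCoforkOfRep hf) ?_
  refine (isColimitMapCoconeCoforkEquiv' S (comp_cokerProj_eq_zero_of_rep hf)).symm ?_
  have h1 : IsColimit (CokernelCofork.ofπ (S.map (toIsogHom (cokerProj f)))
      (show S.map (toIsogHom f) ≫ S.map (toIsogHom (cokerProj f)) = 0 by
        rw [← S.map_comp, ← toIsogHom_comp, comp_cokerProj, toIsogHom_zero, S.map_zero]) :
      CokernelCofork (S.map (toIsogHom f))) :=
    isColimitCoforkMapOfIsColimit' (toIsogeny ⋙ S) (comp_cokerProj f) (cokernelIsColimit f)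
  have hSφ : S.map φ = S.map (inv (toIsogHom (intMul (of X) n))) ≫ S.map (toIsogHom f) := by
    rw [← S.map_comp, ← eq_inv_toIsogHom_intMul_comp hf]
  exact isCokernelEpiComp h1 _ hSφ

/-- Instance form: if `Q ⋙ S` preserves finite colimits, `S` preserves all cokernels.
[cite: Brion2016IsogenyCategory, §3.1 p. 10 (p0010 L24–L29)] -/
theorem preservesCokernels_of_preservesFiniteColimits_toIsogeny_comp [PreservesFiniteColimits (toIsogeny ⋙ S)]
    {X Y : TorusIsogenyCat} (φ : X ⟶ Y) : PreservesColimit (parallelPair φ 0) S :=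
  preservesColimit_parallelPair_of_toIsogeny_comp S (fun _ ↦ inferInstance) φ

end Cokernels

/-! ## §4 Exactness: `S` is exact as soon as `Q ⋙ S` is -/

section Exact

variable [Preadditive D] [HasZeroObject D] (S : TorusIsogenyCat ⥤ D)

/-- **`S` PRESERVES FINITE LIMITS AS SOON AS `Q ⋙ S` DOES** (for a preadditive target with a zero
object; Brion: `D` abelian). [cite: Brion2016IsogenyCategory, §3.1 p. 10 (p0010 L24–L29: "there exists a unique exact functor S")] -/
theorem preservesFiniteLimits_of_toIsogeny_comp [PreservesFiniteLimits (toIsogeny ⋙ S)] :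
    PreservesFiniteLimits S := by
  haveI : S.PreservesZeroMorphisms := preservesZeroMorphisms_of_toIsogeny_comp S
  haveI : ∀ {X Y : TorusIsogenyCat} (φ : X ⟶ Y), PreservesLimit (parallelPair φ 0) S :=
    fun φ ↦ preservesKernels_of_preservesFiniteLimits_toIsogeny_comp S φ
  exact Functor.preservesFiniteLimits_of_preservesKernels S

/-- **`S` PRESERVES FINITE COLIMITS AS SOON AS `Q ⋙ S` DOES.** [cite: Brion2016IsogenyCategory, §3.1 p. 10 (p0010 L24–L29)] -/
theorem preservesFiniteColimits_of_toIsogeny_comp [PreservesFiniteColimits (toIsogeny ⋙ S)] :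
    PreservesFiniteColimits S := by
  haveI : S.PreservesZeroMorphisms := preservesZeroMorphisms_of_toIsogeny_comp S
  haveI : ∀ {X Y : TorusIsogenyCat} (φ : X ⟶ Y), PreservesColimit (parallelPair φ 0) S :=
    fun φ ↦ preservesCokernels_of_preservesFiniteColimits_toIsogeny_comp S φ
  exact Functor.preservesFiniteColimits_of_preservesCokernels S

/-- **`S` is additive as soon as `Q ⋙ S` is left exact** (it then preserves binary products).
[cite: Brion2016IsogenyCategory, §3.1 p. 10 (p0010 L24–L29)] -/
theorem additive_of_toIsogeny_comp [PreservesFiniteLimits (toIsogeny ⋙ S)] : S.Additive := by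
  haveI : S.PreservesZeroMorphisms := preservesZeroMorphisms_of_toIsogeny_comp S
  haveI := preservesFiniteLimits_of_toIsogeny_comp S
  exact Functor.additive_of_preserves_binary_products S

/-- The same statements for a functor `S` given with an ISOMORPHISM `Q ⋙ S ≅ R` to an exact `R` (the
shape of Mathlib's `Localization.lift`): `S` preserves finite limits.
[cite: Brion2016IsogenyCategory, §3.1 p. 10 (p0010 L24–L29)] -/
theorem preservesFiniteLimits_of_iso {R : ComplexTorusCat ⥤ D} (e : toIsogeny ⋙ S ≅ R) [PreservesFiniteLimits R] :
    PreservesFiniteLimits S := by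
  haveI : PreservesFiniteLimits (toIsogeny ⋙ S) := preservesFiniteLimits_of_natIso e.symm
  exact preservesFiniteLimits_of_toIsogeny_comp S

/-- … and finite colimits. [cite: Brion2016IsogenyCategory, §3.1 p. 10 (p0010 L24–L29)] -/
theorem preservesFiniteColimits_of_iso {R : ComplexTorusCat ⥤ D} (e : toIsogeny ⋙ S ≅ R)
    [PreservesFiniteColimits R] : PreservesFiniteColimits S := by
  haveI : PreservesFiniteColimits (toIsogeny ⋙ S) := preservesFiniteColimits_of_natIso e.symm
  exact preservesFiniteColimits_of_toIsogeny_comp S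

end Exact

/-! ## §5 Brion's universal property of `Q` among exact functors -/

section Universal

variable [Preadditive D] [HasZeroObject D] (R : ComplexTorusCat ⥤ D) (hR : isogenies.IsInvertedBy R)

/-- **The functor `S = lift R` induced on the isogeny category by a LEFT EXACT functor `R` inverting the
isogenies is left exact.** [cite: Brion2016IsogenyCategory, §3.1 p. 10 (p0010 L24–L29 and L74–L77)] -/
theorem preservesFiniteLimits_lift [PreservesFiniteLimits R] : PreservesFiniteLimits (lift R hR) := by
  haveI : PreservesFiniteLimits (toIsogeny ⋙ lift R hR) := by rw [toIsogeny_comp_lift]; infer_instance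
  exact preservesFiniteLimits_of_toIsogeny_comp _

/-- **… by a RIGHT EXACT functor is right exact.** [cite: Brion2016IsogenyCategory, §3.1 p. 10 (p0010 L24–L29 and L74–L77)] -/
theorem preservesFiniteColimits_lift [PreservesFiniteColimits R] : PreservesFiniteColimits (lift R hR) := by
  haveI : PreservesFiniteColimits (toIsogeny ⋙ lift R hR) := by rw [toIsogeny_comp_lift]; infer_instance
  exact preservesFiniteColimits_of_toIsogeny_comp _

/-- The induced functor of a left exact `R` is additive. [cite: Brion2016IsogenyCategory, §3.1 p. 10 (p0010 L24–L29)] -/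
theorem additive_lift [PreservesFiniteLimits R] : (lift R hR).Additive := by
  haveI : PreservesFiniteLimits (toIsogeny ⋙ lift R hR) := by rw [toIsogeny_comp_lift]; infer_instance
  exact additive_of_toIsogeny_comp _

/-- The same for Mathlib's lift along the localisation functor `Q` (`Localization.lift R hR Q`, defined up
to the isomorphism `Localization.fac`). [cite: Brion2016IsogenyCategory, §3.1 p. 10 (p0010 L24–L29)] -/
theorem preservesFiniteLimits_localizationLift [PreservesFiniteLimits R] :
    PreservesFiniteLimits (Localization.lift R hR toIsogeny) :=
  preservesFiniteLimits_of_iso _ (Localization.fac R hR toIsogeny)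

/-- … and finite colimits. [cite: Brion2016IsogenyCategory, §3.1 p. 10 (p0010 L24–L29)] -/
theorem preservesFiniteColimits_localizationLift [PreservesFiniteColimits R] :
    PreservesFiniteColimits (Localization.lift R hR toIsogeny) :=
  preservesFiniteColimits_of_iso _ (Localization.fac R hR toIsogeny)

/-- **BRION §3.1, THE UNIVERSAL PROPERTY OF `Q` AMONG EXACT FUNCTORS, for complex tori**: "given an exact
functor `R : C → D`, where `D` is an abelian category, such that [`R` inverts the isogenies], there exists
a unique exact functor `S : C/F → D` such that `R = S ∘ Q`" — here for every preadditive `D` with a zero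
object: there is exactly one functor `S` with `Q ⋙ S = R`, and it is exact.
[cite: Brion2016IsogenyCategory, §3.1 p. 10 (p0010 L24–L29 and L74–L77)] -/
theorem existsUnique_exact_toIsogeny_comp_eq (hR : isogenies.IsInvertedBy R) [PreservesFiniteLimits R]
    [PreservesFiniteColimits R] :
    ∃! S : TorusIsogenyCat ⥤ D, toIsogeny ⋙ S = R ∧ PreservesFiniteLimits S ∧ PreservesFiniteColimits S :=
  ⟨lift R hR, ⟨toIsogeny_comp_lift R hR, preservesFiniteLimits_lift R hR, preservesFiniteColimits_lift R hR⟩,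
    fun S hS ↦ functor_ext_of_toIsogeny_comp_eq S _ (hS.1.trans (toIsogeny_comp_lift R hR).symm)⟩

/-- **Every functor `S` with `Q ⋙ S = R` exact is exact** (exactness is automatic for the factorisation).
[cite: Brion2016IsogenyCategory, §3.1 p. 10 (p0010 L74–L77: "factors uniquely through")] -/
theorem exact_of_toIsogeny_comp_eq [PreservesFiniteLimits R] [PreservesFiniteColimits R]
    (S : TorusIsogenyCat ⥤ D) (hS : toIsogeny ⋙ S = R) : PreservesFiniteLimits S ∧ PreservesFiniteColimits S := by
  subst hS
  exact ⟨preservesFiniteLimits_of_toIsogeny_comp S, preservesFiniteColimits_of_toIsogeny_comp S⟩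

end Universal

/-! ### Bundled form: Mathlib's category `C ⥤ₑ D` of exact functors -/

section Bundled

variable [Preadditive D] [HasZeroObject D]

/-- **`Q` as an exact functor** (an object of Mathlib's `ComplexTorusCat ⥤ₑ TorusIsogenyCat`; g9-#1).
[cite: Brion2016IsogenyCategory, §3.1 p. 10 (p0010 L15–L19: "an exact functor Q")] -/
def toIsogenyExact : ComplexTorusCat ⥤ₑ TorusIsogenyCat :=
  ⟨toIsogeny, ⟨inferInstanceAs (PreservesFiniteLimits toIsogeny), inferInstanceAs (PreservesFiniteColimits toIsogeny)⟩⟩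

/-- The underlying functor of `toIsogenyExact` is `Q`. [cite: Brion2016IsogenyCategory, §3.1 p. 10 (p0010 L15–L19)] -/
@[simp] theorem toIsogenyExact_obj : toIsogenyExact.obj = toIsogeny := rfl

/-- **The exact functor `S : TorusIsogenyCat ⥤ₑ D` induced by an exact functor `R : ComplexTorusCat ⥤ₑ D`
inverting the isogenies.** [cite: Brion2016IsogenyCategory, §3.1 p. 10 (p0010 L24–L29)] -/
def liftExact (R : ComplexTorusCat ⥤ₑ D) (hR : isogenies.IsInvertedBy R.obj) : TorusIsogenyCat ⥤ₑ D :=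
  ⟨lift R.obj hR, by
    haveI := R.property.1
    haveI := R.property.2
    exact ⟨preservesFiniteLimits_lift R.obj hR, preservesFiniteColimits_lift R.obj hR⟩⟩

/-- The underlying functor of the exact lift is g8-#1's `lift`. [cite: Brion2016IsogenyCategory, §3.1 p. 10 (p0010 L24–L29)] -/
@[simp] theorem liftExact_obj (R : ComplexTorusCat ⥤ₑ D) (hR : isogenies.IsInvertedBy R.obj) :
    (liftExact R hR).obj = lift R.obj hR := rfl

/-- `R = S ∘ Q` for the exact lift. [cite: Brion2016IsogenyCategory, §3.1 p. 10 (p0010 L24–L29: "such that R = S ∘ Q")] -/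
theorem toIsogeny_comp_liftExact (R : ComplexTorusCat ⥤ₑ D) (hR : isogenies.IsInvertedBy R.obj) :
    toIsogeny ⋙ (liftExact R hR).obj = R.obj :=
  toIsogeny_comp_lift R.obj hR

/-- **"There exists a unique exact functor `S : C/F → D` such that `R = S ∘ Q`"**, in Mathlib's category of
exact functors. [cite: Brion2016IsogenyCategory, §3.1 p. 10 (p0010 L24–L29)] -/
theorem existsUnique_exactFunctor (R : ComplexTorusCat ⥤ₑ D) (hR : isogenies.IsInvertedBy R.obj) :
    ∃! S : TorusIsogenyCat ⥤ₑ D, toIsogeny ⋙ S.obj = R.obj := by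
  refine ⟨liftExact R hR, toIsogeny_comp_liftExact R hR, fun S hS ↦ ?_⟩
  have h : S.obj = (liftExact R hR).obj :=
    functor_ext_of_toIsogeny_comp_eq S.obj _ (hS.trans (toIsogeny_comp_liftExact R hR).symm)
  cases S
  cases h
  rfl

end Bundled

/-! ## §6 Consequences and validation -/

section Validation

/-- **Validation (the hypotheses are inhabited): `R = Q` itself** is an exact functor inverting the
isogenies (g9-#1), its induced functor is the identity (g8-#1 `lift_toIsogeny`), and the theorem returns the
exactness of `𝟭`. [cite: Brion2016IsogenyCategory, §3.1 p. 10 (p0010 L15–L19: "an exact functor Q")] -/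
theorem preservesFiniteLimits_lift_toIsogeny :
    PreservesFiniteLimits (lift toIsogeny isogenies_isInvertedBy_toIsogeny) ∧
      PreservesFiniteColimits (lift toIsogeny isogenies_isInvertedBy_toIsogeny) :=
  ⟨preservesFiniteLimits_lift _ _, preservesFiniteColimits_lift _ _⟩

/-- **Validation: the unique exact functor through which `Q` factors is the identity of the isogeny
category.** [cite: Brion2016IsogenyCategory, §3.1 p. 10 (p0010 L24–L29)] -/
theorem existsUnique_exact_toIsogeny : ∃! S : TorusIsogenyCat ⥤ TorusIsogenyCat,
    toIsogeny ⋙ S = toIsogeny ∧ PreservesFiniteLimits S ∧ PreservesFiniteColimits S :=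
  existsUnique_exact_toIsogeny_comp_eq toIsogeny isogenies_isInvertedBy_toIsogeny

/-- … namely `S = 𝟭`. [cite: Brion2016IsogenyCategory, §3.1 p. 10 (p0010 L24–L29)] -/
theorem lift_toIsogeny_eq_id : lift toIsogeny isogenies_isInvertedBy_toIsogeny = 𝟭 TorusIsogenyCat := lift_toIsogeny

/-- **An exact functor on the isogeny category preserves monomorphisms and epimorphisms; so does the lift of
an exact `R`** — `S(f ⊗ 1) = R(f)` is a monomorphism iff … (Lemma 3.1 (iii) transported).
[cite: Brion2016IsogenyCategory, §3.1 Lemma 3.1 (iii) (p0010 L52–L56)] -/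
theorem preservesMonomorphisms_lift [Preadditive D] [HasZeroObject D] (R : ComplexTorusCat ⥤ D)
    (hR : isogenies.IsInvertedBy R) [PreservesFiniteLimits R] : (lift R hR).PreservesMonomorphisms := by
  haveI := preservesFiniteLimits_lift R hR
  infer_instance

/-- Dually for epimorphisms. [cite: Brion2016IsogenyCategory, §3.1 Lemma 3.1 (iii) (p0010 L52–L56)] -/
theorem preservesEpimorphisms_lift [Preadditive D] [HasZeroObject D] (R : ComplexTorusCat ⥤ D)
    (hR : isogenies.IsInvertedBy R) [PreservesFiniteColimits R] : (lift R hR).PreservesEpimorphisms := by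
  haveI := preservesFiniteColimits_lift R hR
  infer_instance

/-- **A left exact `R` inverting the isogenies sends holomorphic homomorphisms with finite kernel to
monomorphisms** (`f` mono in `ComplexTorusCat` ⟹ `Q f` mono ⟹ `R f = S(Q f)` mono).
[cite: Brion2016IsogenyCategory, §3.1 Lemma 3.1 (iii) (p0010 L52–L56)] -/
theorem map_mono_of_exact [Preadditive D] [HasZeroObject D] (R : ComplexTorusCat ⥤ D)
    (hR : isogenies.IsInvertedBy R) [PreservesFiniteLimits R] {X Y : ComplexTorusCat} (f : X ⟶ Y) [Mono f] :
    Mono (R.map f) := by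
  haveI := preservesMonomorphisms_lift R hR
  haveI : Mono (toIsogHom f) := (mono_iff_mono_toIsogHom f).1 ‹_›
  have h : R.map f = (lift R hR).map (toIsogHom f) := (liftMap_toIsogHom R hR f).symm
  rw [h]
  exact (lift R hR).map_mono (toIsogHom f)

/-- Dually: a right exact `R` inverting the isogenies sends surjective holomorphic homomorphisms to
epimorphisms. [cite: Brion2016IsogenyCategory, §3.1 Lemma 3.1 (iii) (p0010 L52–L56)] -/
theorem map_epi_of_exact [Preadditive D] [HasZeroObject D] (R : ComplexTorusCat ⥤ D)
    (hR : isogenies.IsInvertedBy R) [PreservesFiniteColimits R] {X Y : ComplexTorusCat} (f : X ⟶ Y) [Epi f] :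
    Epi (R.map f) := by
  haveI := preservesEpimorphisms_lift R hR
  haveI : Epi (toIsogHom f) := (epi_iff_epi_toIsogHom f).1 ‹_›
  have h : R.map f = (lift R hR).map (toIsogHom f) := (liftMap_toIsogHom R hR f).symm
  rw [h]
  exact (lift R hR).map_epi (toIsogHom f)

end Validation

end ComplexTorusCat

end Literature.AlgebraicGeometry.HodgeTheory

end
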